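import Summits.Ventures.CertifiedManyBodySolver.Certificates.HubRm2uTierP.Head
import Summits.Ventures.CertifiedManyBodySolver.Certificates.HubRm2uTierP.Hints001
import Summits.Ventures.CertifiedManyBodySolver.Certificates.HubRm2uTierP.Chain001

/-!
# tier-P instance (HubRm2u-R13-W3) — chain file 2 of 96: steps 5..8 (topology (B): eval%-chained accumulators, no literals, import-serial)

Generated by hubbard-algo-p2's untrusted exporter (emit_v0.py + emit_w3.py); every datum below is re-derived / re-checked by the kernel chain
(`stepEQA`, Rows/CorrWindowCertKernelChainQuotAdj.lean) or is inert. HONEST FRAMING (xx1): instance data / kernel replay of a CONTROL/CALIBRATION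
certificate (hub-Rm2-u′, 4^40-dyadic two-level Gram factors); nothing here is a theorem about the Hubbard model; no summit statement. [cite: Han2020Bootstrap, §3]
-/

set_option linter.style.longLine false
set_option maxRecDepth 100000
set_option maxHeartbeats 0

namespace Summit.Ventures.CertifiedManyBodySolver
namespace CARPolyWindow.TierP.HubRm2u
open Summit.Ventures.CertifiedQuantumChemistry Summit.Ventures.CertifiedQuantumChemistry.CARPoly
open Literature.MathematicalPhysics.QuantumLattice Literature.MathematicalPhysics.QuantumLattice.HubbardWave0
open Literature.Probability.LatticeModels
open CARPolyWindow CARPolyWindow.BoxGeom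

/-- accumulator after step 6 (evaluated at elaboration; the kernel re-derives it in `step_5`). [folklore] -/
def C6 : SOSDual.EncPoly := eval% stepEQA D 2048 C5 (slices.getD 5 []) (hintsOfCodes Dr reps HC5)

/-- KERNEL FACT, step 5 of 350. [folklore] -/
theorem step_5 : C6 = stepEQA D 2048 C5 (slices.getD 5 []) (hintsOfCodes Dr reps HC5) :=
  eq_of_beq (by decide +kernel)

/-- accumulator after step 7 (evaluated at elaboration; the kernel re-derives it in `step_6`). [folklore] -/
def C7 : SOSDual.EncPoly := eval% stepEQA D 2048 C6 (slices.getD 6 []) (hintsOfCodes Dr reps HC6)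

/-- KERNEL FACT, step 6 of 350. [folklore] -/
theorem step_6 : C7 = stepEQA D 2048 C6 (slices.getD 6 []) (hintsOfCodes Dr reps HC6) :=
  eq_of_beq (by decide +kernel)

/-- accumulator after step 8 (evaluated at elaboration; the kernel re-derives it in `step_7`). [folklore] -/
def C8 : SOSDual.EncPoly := eval% stepEQA D 2048 C7 (slices.getD 7 []) (hintsOfCodes Dr reps HC7)

/-- KERNEL FACT, step 7 of 350. [folklore] -/
theorem step_7 : C8 = stepEQA D 2048 C7 (slices.getD 7 []) (hintsOfCodes Dr reps HC7) :=
  eq_of_beq (by decide +kernel)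

/-- accumulator after step 9 (evaluated at elaboration; the kernel re-derives it in `step_8`). [folklore] -/
def C9 : SOSDual.EncPoly := eval% stepEQA D 2048 C8 (slices.getD 8 []) (hintsOfCodes Dr reps HC8)

/-- KERNEL FACT, step 8 of 350. [folklore] -/
theorem step_8 : C9 = stepEQA D 2048 C8 (slices.getD 8 []) (hintsOfCodes Dr reps HC8) :=
  eq_of_beq (by decide +kernel)


end CARPolyWindow.TierP.HubRm2u
end Summit.Ventures.CertifiedManyBodySolver
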